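import Summits.BirchSwinnertonDyer.BirchSwinnertonDyer.Theorems.GenusKolyvaginAtTwoMinimalTwinBSDTwoIdentityDoorKeyLemma
import Summits.BirchSwinnertonDyer.BirchSwinnertonDyer.Theorems.GenusKolyvaginAtTwoGenusPrimitiveSupplyAtTwoLoweringPrime
import HarnessLib

/-!
# Route `GenusKolyvaginAtTwo`, crux U₂ `MinimalTwinBSDTwo` (stmt-BirchSwinnertonDyer-22985), LINE 23 «twin_swap»: THE IDENTITY-PRIME DOOR, part 4b —
# IDENTITY TWISTING PRIMES FOR TWO CLASSES EXIST (Čebotarev, unconditionally): on `Δ > 0`, for independent `x, y ∈ H¹(ℚ, E[2])`, primes `ℓ ≡ −1 (m)`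
# whose Frobenius FIXES `E[2]` and at which `x`, `y`, `x + y` all localise non-trivially

Seat `bsd-line-gk2-p2` g26 (PROVER seat 2/3, cell `bsd-f1-sign2`, LINE 23 holder), `--supports stmt-BirchSwinnertonDyer-22985` (helper; closes nothing).
THEOREMS ONLY (no definition, no named fact, no `sorry`); standard axioms; UNCONDITIONAL (Čebotarev is the tree theorem
`Automorphic.chebotarev_artinRep_holds` via `absoluteGaloisGroup.frobenius_dense`).  **BSD is NOT proved by this file; nothing is closed.**
Sequel of `…IdentityDoorKeyLemma` (§2 `exists_torsionFixing_fix_h1Eval_eq_pair`); the local criterion for a torsion-fixing Frobenius itself is gk2's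
`GenusKolyLowering.not_mem_torsionLocalKer_of_h1Eval_frob_ne_zero` (`…LoweringPrime`).

* §3 **`exists_identityPrime_pair`** — for `W/ℚ` elliptic with `Δ_W > 0`, `ρ̄_{W,2}` onto, a complex conjugation `c₀`, `x, y ∈ H¹(ℚ, E[2])` with `x, y, x + y ≠ 0`,
  `m ≥ 1`, `b`: a prime `ℓ > b`, `ℓ ∤ m`, `m ∣ ℓ + 1`, an arithmetic Frobenius at `ℓ` acting TRIVIALLY on `E[2]` (identity prime), and
  `x, y, x + y ∉ ker (H¹(ℚ, E[2]) → H¹(ℚ_ℓ, E[2]))`.  Proof: gk2-p4's `exists_twistingPrime` (Mazur–Rubin 2010 §§3–4 at `p = 2` over `ℚ`) run with the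
  two-class key lemma: `h₀ ∈ Γ_{ℚ(E[2], μ_m)}` with `[x, h₀] = a − [x, c₀]`, `[y, h₀] = z a − [y, c₀]`; a Frobenius `γ` in the open set
  `c₀ h₀ · (𝒩_{x,y} ∩ Stab μ_m)`; `γ` inverts `μ_m` so `m ∣ ℓ + 1`; `γ ∈ Γ_{ℚ(E[2])}` (as `c₀` is, `Δ > 0`) with `[x, γ] = a`, `[y, γ] = z a`,
  `[x + y, γ] = a + z a`, all non-zero; `GenusKolyLowering.not_mem_torsionLocalKer_of_h1Eval_frob_ne_zero`.
* §4 `exists_identityPrime_pair_not_mem_strictLocalKer` — the same in the line's currency (`ℓ ≡ 7 (mod 8)`, `p ∣ N → p ∣ ℓ + 1`, `ℓ ∤ 2N`,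
  `MazurRubin2010.strictLocalKer`).

References: [MazurRubin2010] Prop. 3.3, Lemma 3.5; [GrossLMS1991] §9 Prop. 9.1, 9.6; [McCallumLMS1991] §3; [SerreAbelianLadic1968] I §2.2.
-/

set_option linter.dupNamespace false -- tree convention: `Summit.BirchSwinnertonDyer.BirchSwinnertonDyer.Theorems` (summit = sub-problem)
set_option autoImplicit false

noncomputable section

open scoped Classical Pointwise

namespace Summit.BirchSwinnertonDyer.BirchSwinnertonDyer.Theorems.GenusExact.TwinSwap.IdentityDoor

open WeierstrassCurve NumberField IsDedekindDomain Field
open Literature.NumberTheory.GaloisRepresentations Literature.NumberTheory.EllipticCurves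
open Literature.NumberTheory
open Summit.BirchSwinnertonDyer.BirchSwinnertonDyer.Theorems.GenusKolyTwistingPrime

/-! ## §3 Identity twisting primes for two classes (Čebotarev) -/

section Main

variable (W : WeierstrassCurve ℚ) [W.IsElliptic]

/-- **IDENTITY TWISTING PRIMES FOR TWO CLASSES EXIST (unconditionally).**  Let `E = W/ℚ` be elliptic with `Δ(W) > 0` and `ρ̄_{E,2}` onto, `c₀` a complex
conjugation (it FIXES `E[2]`: all three `2`-division abscissae are real), `x, y ∈ H¹(ℚ, E[2])` with `x ≠ 0`, `y ≠ 0`, `x ≠ y`, `m ≥ 1` and `b` a bound.  Then there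
is a prime `ℓ > b`, `ℓ ∤ m`, with
* `m ∣ ℓ + 1` (for `8N ∣ m`: `ℓ ≡ 7 (mod 8)` and `ℓ ≡ −1 (mod p)` for every `p ∣ N`, so `−ℓ` is Heegner for `N` with `2` split),
* an arithmetic Frobenius at `ℓ` acting on `E[2]` as `c₀`, i.e. TRIVIALLY (an IDENTITY prime: the `2`-division cubic splits mod `ℓ`, `#E(ℚ_ℓ)[2] = 4`), and
* **`x_ℓ ≠ 0`, `y_ℓ ≠ 0`, `(x + y)_ℓ ≠ 0`** in `H¹(ℚ_ℓ, E[2])` — the localisation at `ℓ` is INJECTIVE on the Klein four-group `{0, x, y, x + y}`.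
Proof: §2 gives `h₀ ∈ Γ_{ℚ(E[2], μ_m)}` with `[x, h₀] = a − [x, c₀]`, `[y, h₀] = z a − [y, c₀]` for some `a ≠ 0` and `z` of order `3` without fixed points; the open set
`c₀ h₀ · (𝒩_{x,y} ∩ Stab μ_m)` of `Γ_ℚ` contains a Frobenius `γ` at a place `v ∤ m`, `v > b` (Čebotarev: `frobenius_dense`, proved in the tree); `γ` inverts `μ_m`,
so `m ∣ ℓ + 1`; `γ ∈ Γ_{ℚ(E[2])}` with `[x, γ] = a`, `[y, γ] = z a`, `[x + y, γ] = a + z a`, all non-zero; gk2's local criterion for a torsion-fixing Frobenius; finally `ℚ_v ≅ ℚ_ℓ`.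
[cite: MazurRubin2010, Prop. 3.3 and Lemma 3.5 (twisting primes via Čebotarev)] [cite: GrossLMS1991, §9 Prop. 9.6] [cite: McCallumLMS1991, §3 Cor. 3.2] -/
theorem exists_identityPrime_pair (hsurj : W.HasSurjectiveModNGaloisRep 2) (hΔ : 0 < W.Δ)
    {c₀ : absoluteGaloisGroup ℚ} (hc₀ : IsComplexConjugation (Rat.castHom ℝ) c₀)
    {x y : galH1Torsion W (2 : ℤ)} (hx : x ≠ 0) (hy : y ≠ 0) (hxy : x ≠ y) {m : ℕ} (hm : m ≠ 0) (b : ℕ) :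
    ∃ ℓ : ℕ, ∃ _ : Fact ℓ.Prime, b < ℓ ∧ ¬ ℓ ∣ m ∧ m ∣ ℓ + 1 ∧
      (∃ (v : HeightOneSpectrum (𝓞 ℚ)) (𝔓 : Ideal (absIntegers (𝓞 ℚ) ℚ))
          (F : absoluteGaloisGroup ℚ), (ℓ : 𝓞 ℚ) ∈ v.asIdeal ∧ 𝔓 ∈ v.primesAbove ∧
          IsArithFrobAt (𝓞 ℚ) F 𝔓 ∧ ∀ P : geomTorsion W (2 : ℤ), F • P = P) ∧
      x ∉ W.torsionLocalKer ℚ_[ℓ] (2 : ℤ) ∧ y ∉ W.torsionLocalKer ℚ_[ℓ] (2 : ℤ) ∧ x + y ∉ W.torsionLocalKer ℚ_[ℓ] (2 : ℤ) := by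
  classical
  haveI : NeZero m := ⟨hm⟩
  have hn0 : (2 : ℤ) ≠ 0 := two_ne_zero
  -- `c₀` fixes `E[2]` (`Δ > 0`)
  have hc₀T : c₀ ∈ torsionFixing W (2 : ℤ) :=
    (mem_torsionFixing_iff W (2 : ℤ)).mpr fun P ↦ GenusKolySign.twoTorsion_smul_eq_of_Δ_pos W hΔ hc₀ P
  -- elementary facts on `E[2]`
  have hV2 : ∀ v : geomTorsion W (2 : ℤ), v + v = 0 := fun v ↦ by
    rw [← two_nsmul]; exact AddSubgroup.torsionBy.nsmul v
  -- a non-zero `a ∈ E[2]` and an element `z` of order `3` without fixed points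
  haveI : Finite (geomTorsion W (2 : ℤ)) := Nat.finite_of_card_ne_zero (by rw [natCard_geomTorsion_two_rat W]; norm_num)
  haveI : Nontrivial (geomTorsion W (2 : ℤ)) := by
    rw [← Finite.one_lt_card_iff_nontrivial, natCard_geomTorsion_two_rat W]; norm_num
  obtain ⟨a, ha⟩ := exists_ne (0 : geomTorsion W (2 : ℤ))
  obtain ⟨z, -, hzfix⟩ := exists_smul_three_rat W hsurj
  have hza0 : z • a ≠ 0 := fun h ↦ ha ((smul_eq_zero_iff_eq z).mp h)
  have hzaa : z • a ≠ a := fun h ↦ ha (hzfix _ h)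
  have hsum : a + z • a ≠ 0 := fun h ↦
    hzaa ((eq_neg_of_add_eq_zero_right h).trans (neg_eq_of_add_eq_zero_right (hV2 a)))
  -- a primitive `m`-th root of unity in `ℚ̄`
  have hq0 : ((m : ℕ) : AlgebraicClosure ℚ) ≠ 0 := by exact_mod_cast hm
  haveI : NeZero ((m : ℕ) : AlgebraicClosure ℚ) := ⟨hq0⟩
  obtain ⟨ζ, hζ⟩ := IsAlgClosed.exists_root (Polynomial.cyclotomic m (AlgebraicClosure ℚ))
    (Polynomial.degree_cyclotomic_pos m _ (Nat.pos_of_ne_zero hm)).ne'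
  have hprim : IsPrimitiveRoot ζ m := Polynomial.isRoot_cyclotomic_iff.mp hζ
  -- ### the two-class key lemma: `h₀ ∈ Γ_{ℚ(E[2], ζ)}` with prescribed values
  obtain ⟨h₀, hh₀T, hh₀ζ, hh₀x, hh₀y⟩ := exists_torsionFixing_fix_h1Eval_eq_pair W hsurj hx hy hxy hprim
    (a - h1Eval W (2 : ℤ) x c₀) (z • a - h1Eval W (2 : ℤ) y c₀)
  -- ### the finite exceptional set of places of `ℚ`
  set B : Finset ℕ := m.primeFactors ∪ Finset.range (b + 1) with hB
  set S : Set (HeightOneSpectrum (𝓞 ℚ)) := {v | ∃ q ∈ B, q.Prime ∧ (q : 𝓞 ℚ) ∈ v.asIdeal}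
    with hS
  have hSfin : S.Finite := by
    have : S ⊆ ⋃ q ∈ (B.filter Nat.Prime), {v | (q : 𝓞 ℚ) ∈ v.asIdeal} := by
      intro v ⟨q, hqB, hq, hqv⟩
      simp only [Set.mem_iUnion, Finset.mem_filter]
      exact ⟨q, ⟨hqB, hq⟩, hqv⟩
    refine Set.Finite.subset (Set.Finite.biUnion (Finset.finite_toSet _) fun q hq ↦ ?_) this
    rw [Finset.coe_filter, Set.mem_setOf_eq] at hq
    have hsub : {v : HeightOneSpectrum (𝓞 ℚ) | (q : 𝓞 ℚ) ∈ v.asIdeal}.Subsingleton :=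
      fun v hv v' hv' ↦ HeightOneSpectrum.eq_of_natCast_mem_rat hq.2 hv hv'
    exact hsub.finite
  -- ### Čebotarev: a Frobenius in the open set `c₀ h₀ · (𝒩 ∩ Stab ζ)`
  set 𝒩 := evalKer W (2 : ℤ) ![x, y] with h𝒩
  have h𝒩open : IsOpen (𝒩 : Set (absoluteGaloisGroup ℚ)) :=
    isOpen_evalKer W _ _ (isOpen_torsionFixing W hn0)
  set A : Subgroup (absoluteGaloisGroup ℚ) := MulAction.stabilizer (absoluteGaloisGroup ℚ) ζ with hA
  have hAopen : IsOpen (A : Set (absoluteGaloisGroup ℚ)) := by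
    haveI : FiniteDimensional ℚ (IntermediateField.adjoin ℚ {ζ}) :=
      IntermediateField.adjoin.finiteDimensional
        ((AlgebraicClosure.isAlgebraic ℚ).isAlgebraic ζ).isIntegral
    refine Subgroup.isOpen_mono (H₁ := (IntermediateField.adjoin ℚ {ζ}).fixingSubgroup) ?_
      (IntermediateField.fixingSubgroup_isOpen _)
    intro σ hσ
    rw [IntermediateField.mem_fixingSubgroup_iff] at hσ
    exact hσ ζ (IntermediateField.mem_adjoin_simple_self ℚ ζ)
  set U : Set (absoluteGaloisGroup ℚ) := (𝒩 : Set _) ∩ (A : Set _) with hU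
  have hUopen : IsOpen U := h𝒩open.inter hAopen
  set O : Set (absoluteGaloisGroup ℚ) := (fun γ ↦ c₀ * h₀ * γ) '' U with hO
  have hOopen : IsOpen O := (Homeomorph.mulLeft (c₀ * h₀)).isOpenMap _ hUopen
  have hOne : O.Nonempty := ⟨c₀ * h₀ * 1, 1, ⟨𝒩.one_mem, A.one_mem⟩, rfl⟩
  obtain ⟨γ, hγO, v, hvS, 𝔓₀, h𝔓₀, hγ⟩ :=
    (absoluteGaloisGroup.frobenius_dense Automorphic.chebotarev_artinRep_holds ℚ S hSfin
      ).inter_open_nonempty O hOopen hOne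
  obtain ⟨u, ⟨hu𝒩, huA⟩, rfl⟩ := hγO
  beta_reduce at hγ
  have huT : u ∈ torsionFixing W (2 : ℤ) := hu𝒩.1
  have hux : h1Eval W (2 : ℤ) x u = 0 := hu𝒩.2 0
  have huy : h1Eval W (2 : ℤ) y u = 0 := hu𝒩.2 1
  have huζ : u • ζ = ζ := huA
  set t := h₀ * u with ht
  have htT : t ∈ torsionFixing W (2 : ℤ) := mul_mem hh₀T huT
  have hγt : c₀ * h₀ * u = c₀ * t := by rw [ht, mul_assoc]
  have hγT : c₀ * h₀ * u ∈ torsionFixing W (2 : ℤ) := by rw [hγt]; exact mul_mem hc₀T htT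
  -- ### the rational prime `ℓ` under `v` and `ℚ_v ≅ ℚ_ℓ`
  set ℓ : ℕ := (Rat.HeightOneSpectrum.primesEquiv (R := 𝓞 ℚ) v : ℕ) with hℓdef
  have hℓ : ℓ.Prime := (Rat.HeightOneSpectrum.primesEquiv (R := 𝓞 ℚ) v).2
  haveI hℓF : Fact ℓ.Prime := ⟨hℓ⟩
  have hℓv : (ℓ : 𝓞 ℚ) ∈ v.asIdeal := by
    have h := (Rat.HeightOneSpectrum.natGenerator_dvd_iff (R := 𝓞 ℚ) v (n := ℓ)).mp dvd_rfl
    rw [Ideal.mem_map_iff_of_surjective _ (Rat.IsIntegralClosure.intEquiv (𝓞 ℚ)).surjective] at h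
    obtain ⟨y', hy', hyℓ⟩ := h
    have : y' = (ℓ : 𝓞 ℚ) := (Rat.IsIntegralClosure.intEquiv (𝓞 ℚ)).injective (by rw [hyℓ, map_natCast])
    rwa [this] at hy'
  haveI : CharZero (v.adicCompletion ℚ) :=
    charZero_of_injective_algebraMap (algebraMap ℚ (v.adicCompletion ℚ)).injective
  set θ : v.adicCompletion ℚ ≃+* ℚ_[ℓ] :=
    RingEquivClass.toRingEquiv (Rat.HeightOneSpectrum.adicCompletion.padicEquiv (R := 𝓞 ℚ) v)
    with hθ
  have hℓB : ℓ ∉ B := fun h ↦ hvS ⟨ℓ, h, hℓ, hℓv⟩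
  simp only [hB, Finset.mem_union, Nat.mem_primeFactors, Finset.mem_range, not_or] at hℓB
  obtain ⟨hℓm', hℓb⟩ := hℓB
  have hℓm : ¬ ℓ ∣ m := fun h ↦ hℓm' ⟨hℓ, h, hm⟩
  have hbℓ : b < ℓ := by omega
  -- ### `m ∣ ℓ + 1`: the Frobenius inverts `ζ` (as `c₀` does) and raises it to the `ℓ`-th power
  have hmv : (m : 𝓞 ℚ) ∉ v.asIdeal := natCast_not_mem_of_not_dvd hℓ hℓv hℓm
  have h1 : (c₀ * h₀ * u) • ζ = ζ⁻¹ := by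
    rw [mul_smul, mul_smul, huζ, hh₀ζ, RatClosure.smul_eq_inv_of_pow_eq_one hc₀ hm hprim.pow_eq_one]
  have h2 : (c₀ * h₀ * u) • ζ = ζ ^ v.residueCard :=
    smul_eq_pow_residueCard_of_isArithFrobAt_of_pow_eq_one hmv h𝔓₀ hγ hprim.pow_eq_one
  rw [residueCard_eq_of_natCast_mem_rat hℓ hℓv, h1] at h2
  have hζ0 : ζ ≠ 0 := hprim.ne_zero hm
  have hζ1 : ζ ^ (ℓ + 1) = 1 := by rw [pow_succ, ← h2, inv_mul_cancel₀ hζ0]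
  have hmdvd : m ∣ ℓ + 1 := (hprim.pow_eq_one_iff_dvd (ℓ + 1)).mp hζ1
  -- ### the Frobenius acts on `E[2]` trivially
  have hFE : ∀ P : geomTorsion W (2 : ℤ), (c₀ * h₀ * u) • P = P := fun P ↦ smul_eq_of_mem_torsionFixing W _ hγT P
  -- ### the values `[x, γ] = a`, `[y, γ] = z a`, `[x + y, γ] = a + z a`
  have hvx : h1Eval W (2 : ℤ) x (c₀ * h₀ * u) = a := by
    rw [h1Eval_mul W _ x (mul_mem hc₀T hh₀T), h1Eval_mul W _ x hc₀T, hh₀x, hux, add_zero, add_sub_cancel]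
  have hvy : h1Eval W (2 : ℤ) y (c₀ * h₀ * u) = z • a := by
    rw [h1Eval_mul W _ y (mul_mem hc₀T hh₀T), h1Eval_mul W _ y hc₀T, hh₀y, huy, add_zero, add_sub_cancel]
  have hvxy : h1Eval W (2 : ℤ) (x + y) (c₀ * h₀ * u) = a + z • a := by
    rw [h1Eval_add W _ x y hγT, hvx, hvy]
  -- ### the local criterion at `v`, then transport to `ℚ_ℓ`
  have hvx' : h1Eval W (2 : ℤ) x (c₀ * h₀ * u) ≠ 0 := ne_of_eq_of_ne hvx ha
  have hvy' : h1Eval W (2 : ℤ) y (c₀ * h₀ * u) ≠ 0 := ne_of_eq_of_ne hvy hza0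
  have hvxy' : h1Eval W (2 : ℤ) (x + y) (c₀ * h₀ * u) ≠ 0 := ne_of_eq_of_ne hvxy hsum
  have hlocx := GenusKolyLowering.not_mem_torsionLocalKer_of_h1Eval_frob_ne_zero W (n := 2) two_ne_zero h𝔓₀ hγ hγT hvx'
  have hlocy := GenusKolyLowering.not_mem_torsionLocalKer_of_h1Eval_frob_ne_zero W (n := 2) two_ne_zero h𝔓₀ hγ hγT hvy'
  have hlocxy := GenusKolyLowering.not_mem_torsionLocalKer_of_h1Eval_frob_ne_zero W (n := 2) two_ne_zero h𝔓₀ hγ hγT hvxy'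
  refine ⟨ℓ, hℓF, hbℓ, hℓm, hmdvd, ⟨v, 𝔓₀, c₀ * h₀ * u, hℓv, h𝔓₀, hγ, hFE⟩, fun hx' ↦ hlocx ?_, fun hy' ↦ hlocy ?_,
    fun hxy'' ↦ hlocxy ?_⟩
  · exact (mem_torsionLocalKer_padic_iff W θ (2 : ℤ) x).mp hx'
  · exact (mem_torsionLocalKer_padic_iff W θ (2 : ℤ) y).mp hy'
  · exact (mem_torsionLocalKer_padic_iff W θ (2 : ℤ) (x + y)).mp hxy''

end Main

/-! ## §4 In the currency of the line (`MazurRubin2010.strictLocalKer`, `ℓ ≡ 7 (mod 8)`, `p ∣ N → p ∣ ℓ + 1`) -/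

section Corollaries

variable (W : WeierstrassCurve ℚ) [W.IsElliptic]

/-- **Identity twisting primes for two classes, Heegner-compatible form.**  For `W/ℚ` elliptic with `Δ(W) > 0` and `ρ̄_{W,2}` onto, classes
`x, y ∈ H¹(ℚ, E[2])` with `x, y ≠ 0`, `x ≠ y`, any `N ≥ 1` and any bound `b`: a prime `ℓ > b` with `ℓ ∤ 2N`, `ℓ ≡ 7 (mod 8)`, `p ∣ ℓ + 1` for every `p ∣ N`
(so every prime of `N`, and `2`, split in `ℚ(√−ℓ)`: a prime Heegner field for level `N`), a Frobenius at `ℓ` FIXING `E[2]` (identity prime), and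
`x, y, x + y ∉ MazurRubin2010.strictLocalKer W ℚ_[ℓ] 2`.  [cite: MazurRubin2010, Prop. 3.3, Lemma 3.5] [cite: GrossLMS1991, §9 Prop. 9.6] -/
theorem exists_identityPrime_pair_not_mem_strictLocalKer (hsurj : W.HasSurjectiveModNGaloisRep 2) (hΔ : 0 < W.Δ)
    {x y : galH1Torsion W (2 : ℤ)} (hx : x ≠ 0) (hy : y ≠ 0) (hxy : x ≠ y) {N : ℕ} (hN : N ≠ 0) (b : ℕ) :
    ∃ ℓ : ℕ, ∃ _ : Fact ℓ.Prime, b < ℓ ∧ ¬ ℓ ∣ 2 * N ∧ ℓ % 8 = 7 ∧ (∀ p : ℕ, p ∣ N → p ∣ ℓ + 1) ∧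
      (∃ (v : HeightOneSpectrum (𝓞 ℚ)) (𝔓 : Ideal (absIntegers (𝓞 ℚ) ℚ))
          (F : absoluteGaloisGroup ℚ), (ℓ : 𝓞 ℚ) ∈ v.asIdeal ∧ 𝔓 ∈ v.primesAbove ∧
          IsArithFrobAt (𝓞 ℚ) F 𝔓 ∧ ∀ P : geomTorsion W (2 : ℤ), F • P = P) ∧
      x ∉ MazurRubin2010.strictLocalKer W ℚ_[ℓ] (2 : ℤ) ∧ y ∉ MazurRubin2010.strictLocalKer W ℚ_[ℓ] (2 : ℤ) ∧
      x + y ∉ MazurRubin2010.strictLocalKer W ℚ_[ℓ] (2 : ℤ) := by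
  obtain ⟨c₀, hc₀⟩ := exists_isComplexConjugation (Rat.castHom ℝ)
  have hm : 8 * N ≠ 0 := by omega
  obtain ⟨ℓ, hℓF, hbℓ, hℓm, hmdvd, hfrob, hlocx, hlocy, hlocxy⟩ := exists_identityPrime_pair W hsurj hΔ hc₀ hx hy hxy hm b
  refine ⟨ℓ, hℓF, hbℓ, fun h ↦ hℓm (h.trans ⟨4, by ring⟩), ?_, fun p hp ↦ ?_, hfrob, hlocx, hlocy, hlocxy⟩
  · have h8 : 8 ∣ ℓ + 1 := (Dvd.intro N rfl).trans hmdvd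
    omega
  · exact (Dvd.dvd.mul_left hp 8).trans hmdvd

end Corollaries

end Summit.BirchSwinnertonDyer.BirchSwinnertonDyer.Theorems.GenusExact.TwinSwap.IdentityDoor

end
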